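/-
Copyright: the b2b-balaban T⁴-continuum CRUX team, row NE7b leaf lineage `t4-ne7b-formalise-leaf-05` (gen 159). Project licence.
-/
import Literature.MathematicalPhysics.QuantumFieldTheory.Balaban1983to89.Beta.VectorPropagatorDict
import Literature.MathematicalPhysics.QuantumFieldTheory.Balaban1983to89.B5CombesThomasLattice
import Summits.QuantumFields.BalabanUV.T4Continuum.Spine.NE7b.MatrixFormJunction
import Summits.QuantumFields.BalabanUV.T4Continuum.Spine.NE7b.DominationTransfer

/-!
# PRINT's OWN TORUS BLOCK AVERAGE `Q′_k` IS `H¹`-STABLE WITH CONSTANT ONE: for every scalar field `f` on the fine torus `T_η`,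
# `Σ_{⟨y,y+e_μ⟩} |(∂₁ Q′_k f)(y,μ)|² ≤ η^d · Σ_{⟨x,x+ηe_μ⟩} |(∂^η f)(x,μ)|²`, i.e. `⟨Q′_k f, (−Δ₁) Q′_k f⟩₁ ≤ ⟨f, (−Δ^η) f⟩_η` — the fine
# Dirichlet form DOMINATES the pullback of the unit-lattice Dirichlet form under `Q′_k = B5Block118.QsOp`, `γ₀ = 1`, every `d`, every
# `η = 1∕n`, every torus; hence the `hRQ` slot of `…DominationTransfer` is INHABITED for the hard flow's block average on
# `EuclideanSpace ℝ (Tor (fine n M))`, and along ANY section of `Q′_k` the transported fine form dominates the unit-lattice form — the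
# lower direction `γ₀ = 1` of print's (1.67) for the scalar `U = 1` torus flow at every composite level `n = L^k` (row NE7b, node U5c;
# [folklore] over the tree's typed (1.18) ∕ (1.20) ∕ (1.55) BY NAME; `…MatrixFormJunction` + `…DominationTransfer` BY NAME)

Cell `pub-balaban`, sub-cell `t4`, spine estimate NE7b (`T4WeightBudget.RelWeightBound`; the cell's OWN estimate — NOT PRINTED in
[Bałaban 1983–89], NOT PROVED).  Crux-route work under `Spine/NE7b/` by a row leaf (`t4-ne7b-formalise-leaf-05` gen 159) under FREEZE (0)'s
crux-prover clause, on the OWNER's located open object W-ne7bp1-g111-2 (ii) («the torus scalar `H¹`-stability for `B5Block118.QsOp`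
(`Beta.VectorPropagatorDict.QvOp_mul_GradOp` + a `QvOp` Jensen) ⇒ with `…MatrixFormJunction` the hard-flow `hRQ` of DMT on
`EuclideanSpace ℝ (Tor (fine n M))`»).  NOTHING of Bałaban's is asserted: the inputs are the tree's KERNEL theorems about the operators it
typed from the printed definitions — `B5Block118.QsOp` ∕ `QvOp` ((1.20) ∕ (1.18) of [Balaban1984PropagatorsI]), `B5Action121.GradOp` ((1.4)),
the identity (1.55) `Q_k ∂^η = ∂₁ Q′_k` (`Beta.VectorPropagatorDict.QvOp_mul_GradOp`), the entry table of `Q_k` (`B5Prop11G0Torus.qent`, row sums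
`1`, column sums `η^d`; `q ≥ 0`: `B5CombesThomasLattice.qent_nonneg'`) and the reality of the typed operators (`B5RealFields`) — plus this cell's Mathlib-only shapes `…MatrixFormJunction`
(37) and `…DominationTransfer` (DMT) BY NAME.  No `T4Continuum/Support` leaf typed; no `def`; zero `sorry`.

WHY.  The hard-step cell's floor direction is `…DominationTransfer` (DMT): if the fine form dominates the pullback of a coarse MODEL form,
`γ·R (D x) (D x) ≤ Q x x`, then every transported form `Q[T·,T·]` along a section of `D` dominates `γ·R`, and along a tower nothing is
iterated.  DMT leaves the MODEL HALF — the pullback inequality BY VALUE for block averagings — to its suppliers; the owner's reading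
R-ne7bp1-g111-1 (a) located it on the whole lattice `ℤ^d` (`B5Ineq167LowerZd.energy_blockAvg_le`, Cauchy–Schwarz along the `n+1` translates),
and `…MatrixFormJunction` (37) moved `Matrix` ∕ `dotProduct` letters onto `EuclideanSpace`.  What was OPEN (W-ne7bp1-g111-2 (ii)) is the same
half ON PRINT's OWN TORUS OBJECTS: the block average `Q′_k` of (1.20) on `T_η = Tor (fine n M)` against the two gradients `∂^η`
(`GradOp (fine n M) n`) and `∂₁` (`GradOp M 1`).  Here it is, in three lines: (1.55) says `∂₁ Q′_k f = Q_k ∂^η f` with `Q_k` the BOND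
average (1.18); each row of `Q_k` is a probability vector (`qent_rowsum`), so `|(Q_k A) b|² ≤ Σ_i q(b;i)|A i|²` (Jensen ∕ Cauchy–Schwarz);
and each column of `Q_k` sums to `η^d` (`qent_colsum`: every fine bond lies on exactly `n` averaging segments of weight `η^{d+1}`), so
summing over `b` gives `‖Q_k A‖² ≤ η^d‖A‖²`.  With `A = ∂^η f`: `‖∂₁ Q′_k f‖²₁ ≤ η^d‖∂^η f‖² = ‖∂^η f‖²_η` — the coarse Dirichlet energy of the
block average is at most the fine (`η^d`-weighted) Dirichlet energy, constant ONE, for the one-step AND the composite blocking (any `n = L^k`).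
§3 rewrites this in REAL `dotProduct` currency over `reM` (the typed operators are real: `isReal_QsOp`, `isReal_GradOp`), which is LITERALLY
the hypothesis `h` of `…MatrixFormJunction.domination_transfer` with `γ = 1`; §4 packages the CLM inhabitant of DMT's `hRQ`.

WHAT IS PROVED ([folklore]; `n ≥ 1` via `[NeZero n]`, `M : Fin d → ℕ` with `M μ ≥ 1`, any `d`):
* §1 JENSEN FOR `Q_k` (1.18): `norm_QvOp_mulVec_le` (`‖(Q_k A) b‖ ≤ Σ_i q(b;i)‖A i‖`), **`normSq_QvOp_mulVec_le`**
  (`‖(Q_k A) b‖² ≤ Σ_i q(b;i)‖A i‖²`), **`nsq_QvOp_mulVec_le`** (`Σ_b ‖(Q_k A) b‖² ≤ η^d·Σ_i ‖A i‖²`, `η^d = 1∕n^d`).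
* §2 THE `H¹`-STABILITY OF `Q′_k` (1.20): `GradOp_QsOp_mulVec` (`∂₁ (Q′_k f) = Q_k (∂^η f)`, (1.55) BY NAME), **`nsq_GradOp_QsOp_le`**
  (`Σ_{(y,μ)} ‖(∂₁ Q′_k f)(y,μ)‖² ≤ η^d·Σ_{(x,μ)} ‖(∂^η f)(x,μ)‖²`), `sum_normSq_diff_QsOp_le` (the same in the printed sums
  `Σ_y Σ_μ |(Q′f)(y+e_μ) − (Q′f)(y)|² ≤ η^d·Σ_x Σ_μ |η⁻¹(f(x+ηe_μ) − f(x))|²`), `form_LapS_QsOp_le` (`⟨Q′f, Δ₁ Q′f⟩ ≤ η^d⟨f, Δ^η f⟩` with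
  `Δ = ∂ᴴ∂ = B5Action121.LapS`), **`ipw_LapS_QsOp_le`** (print's weighted currency (1.21): `⟨Q′f, Δ₁Q′f⟩_{w=1} ≤ ⟨f, Δ^ηf⟩_{w=η^d}` — `γ₀ = 1`).
* §3 REAL `dotProduct` CURRENCY: `reM_QsOp_mulVec`, `reM_GradOp_mulVec` (the real actions are the printed sums), `dot_transpose_mul_self`
  (`u ⬝ (BᵀB) u = Σ (Bu)²`), `sum_sq_reM_mulVec`, `coarse_form_eq` ∕ `fine_form_eq` (the two matrix forms ARE the unit-lattice and the
  `η^d`-weighted `η`-lattice Dirichlet energies), **`blockAverage_domination_dot`**: for every `v : Tor (fine n M) → ℝ`,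
  `1·((Dm v) ⬝ (S (Dm v))) ≤ v ⬝ (A v)` with `Dm = reM Q′_k`, `S = (reM ∂₁)ᵀ(reM ∂₁)`, `A = η^d·(reM ∂^η)ᵀ(reM ∂^η)` — the hypothesis `h` of
  `…MatrixFormJunction.domination_transfer`, `γ = 1`.
* §4 THE CLM INHABITANT: **`blockAverage_hRQ`** — `∃ (Q : E →L E →L ℝ) (R : F →L F →L ℝ) (D : E →L F)` on `E = EuclideanSpace ℝ (Tor (fine n M))`,
  `F = EuclideanSpace ℝ (Tor M)`, the three maps CHARACTERISED in coordinates by `A`, `S`, `Dm` above, with `∀ x, 1·R (D x) (D x) ≤ Q x x`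
  (DMT's `hRQ`, `γ = 1`, level-free) and `∀ x, 0 ≤ Q x x`, `∀ g, 0 ≤ R g g`; **`transported_dominates_of_section`** — DMT §1 BY NAME: for ANY
  continuous right inverse `T` of `D` (`D (T g) = g`), `R g g ≤ (Q.bilinearComp T T) g g`: the unit-lattice Dirichlet energy of `g` is at most
  the `η^d`-weighted fine Dirichlet energy of `T g` — at the minimising section, the lower direction `γ₀ = 1` of (1.67) for the scalar torus
  flow at level `n = L^k`, obtained for every section with no minimisation.
* §5 toy: the weight at the composite blocking `n = L^k` is `η^d = L^{−kd}` (`d = 4`, `L = 2`, `k = 3`: `2^{−12}`).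

NOT HERE (honest): the kernel floor of the coarse form (`hR` of DMT: a Poincaré letter of the unit-lattice Dirichlet form on `ker` of the NEXT
averaging — TSPB ∕ CPT ∕ FFTI's currency), the EXISTENCE of a section `T` (block-constant or minimising; HSSG ∕ FFTI ∕ the tree's `B5Hk160Torus`),
the UPPER direction of (1.67) (a size letter of a chosen section — THEC's direction), the `ℓ²(ℤ^d)` carrier (`…FreeFieldBlockingLetters`),
covariant `U ≠ 1` (`Q_k(U)` is not a real scalar average), anything of Bałaban's small-field action ((A3) ∕ (A1c), NC-NE7b-α UNRULED).  BY-NAME EFFECT ON THE WALL: NONE (the hard-step cell's `hRQ` slot is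
inhabited for the free flow; the wall is (R2)).  NE7b NOT PRINTED ∕ NOT PROVED; spine PROVED 0∕9; rung (B)+1 on a FINITE torus — NOT infinite
volume, NOT the mass gap, NOT Clay.  HONEST DEPENDENCY: continuum YM on T⁴ ⇐ BetaPertH ∧ nine spine estimates (0∕9 proved); BetaPertH ⇐ (D1) ∧
(D4) ∧ CAP+tail; G-an2-4 gates asym, D1 and NE2∕3∕4.
-/

set_option autoImplicit false

namespace Summit.QuantumFields.BalabanUV.T4Continuum.NE7b.BlockAverageDirichletDomination

open Matrix WithLp Finset
open Literature.MathematicalPhysics.QuantumFieldTheory.Balaban1983to89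
open B5Prop11Plancherel (Tor fine unitVec)
open B5Prop11Lower (nsq nsq_nonneg star_dotProduct_self)
open B5Action121 (GradOp sdiff LapS ipw GradOp_mulVec sdiff_mulVec GradOp_conjTranspose_mul_GradOp form_gram_rect)
open B5Block118 (QsOp QvOp bpt tstep QsOp_mulVec)
open B5Prop11G0Torus (qent QvOp_eq_qent qent_rowsum qent_colsum)
open B5CombesThomasLattice (qent_nonneg')
open B5RealFields (IsReal reM cplx isReal_QsOp isReal_GradOp nsq_cplx)
open Beta.VectorPropagatorDict (QvOp_mul_GradOp)
open Summit.QuantumFields.BalabanUV.T4Continuum.NE7b.MatrixFormJunction (exists_form exists_map domination_transfer)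
open Summit.QuantumFields.BalabanUV.T4Continuum.NE7b.DominationTransfer (le_transported_of_le_pullback)

variable {d : ℕ} (n : ℕ) [NeZero n] (M : Fin d → ℕ) [hM : ∀ μ, NeZero (M μ)]

/-! ## §1. Jensen for the bond average `Q_k` (1.18): rows are probability vectors, columns sum to `η^d` -/

/-- `(Q_k A) b = Σ_i q(b;i)·A i` with the REAL entry table `q`. [cite: Balaban1984PropagatorsI, (1.18) p.20] -/
theorem QvOp_mulVec_eq_sum_qent (A : Tor (fine n M) × Fin d → ℂ) (b : Tor M × Fin d) :
    (QvOp n M *ᵥ A) b = ∑ i, ((qent n M b i : ℝ) : ℂ) * A i := by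
  simp only [Matrix.mulVec, dotProduct, QvOp_eq_qent]

/-- `‖(Q_k A) b‖ ≤ Σ_i q(b;i)·‖A i‖` (triangle inequality, `q ≥ 0`). [folklore] -/
theorem norm_QvOp_mulVec_le (A : Tor (fine n M) × Fin d → ℂ) (b : Tor M × Fin d) :
    ‖(QvOp n M *ᵥ A) b‖ ≤ ∑ i, qent n M b i * ‖A i‖ := by
  rw [QvOp_mulVec_eq_sum_qent]
  refine (norm_sum_le _ _).trans (le_of_eq (Finset.sum_congr rfl fun i _ => ?_))
  rw [norm_mul, Complex.norm_real, Real.norm_of_nonneg (qent_nonneg' n M b i)]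

/-- **JENSEN, ONE ROW**: `‖(Q_k A) b‖² ≤ Σ_i q(b;i)·‖A i‖²` — Cauchy–Schwarz with the weights `q(b;·)`, whose row sum is `1`
(`B5Prop11G0Torus.qent_rowsum`). [folklore] -/
theorem normSq_QvOp_mulVec_le (A : Tor (fine n M) × Fin d → ℂ) (b : Tor M × Fin d) :
    ‖(QvOp n M *ᵥ A) b‖ ^ 2 ≤ ∑ i, qent n M b i * ‖A i‖ ^ 2 := by
  have h1 : ‖(QvOp n M *ᵥ A) b‖ ^ 2 ≤ (∑ i, qent n M b i * ‖A i‖) ^ 2 :=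
    pow_le_pow_left₀ (norm_nonneg _) (norm_QvOp_mulVec_le n M A b) 2
  have h2 : (∑ i, qent n M b i * ‖A i‖) ^ 2 ≤ (∑ i, qent n M b i) * ∑ i, qent n M b i * ‖A i‖ ^ 2 :=
    Finset.sum_sq_le_sum_mul_sum_of_sq_le_mul _ (fun i _ => qent_nonneg' n M b i)
      (fun i _ => mul_nonneg (qent_nonneg' n M b i) (sq_nonneg _)) (fun i _ => by ring_nf; rfl)
  rw [qent_rowsum, one_mul] at h2
  exact h1.trans h2

/-- **JENSEN, SUMMED**: `Σ_b ‖(Q_k A) b‖² ≤ η^d·Σ_i ‖A i‖²` — the column sums of `q` are `η^d` (`B5Prop11G0Torus.qent_colsum`: every fine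
bond lies on exactly `n` of the `η^{d+1}`-weighted averaging segments).  Equivalently `‖Q_k A‖²_{ℓ²(T₁)} ≤ ‖A‖²_{L²(T_η)}` in print's
weighted norms: the bond average is a contraction. [folklore] -/
theorem nsq_QvOp_mulVec_le (A : Tor (fine n M) × Fin d → ℂ) :
    nsq (QvOp n M *ᵥ A) ≤ 1 / (n : ℝ) ^ d * nsq A := by
  calc nsq (QvOp n M *ᵥ A) = ∑ b, ‖(QvOp n M *ᵥ A) b‖ ^ 2 := rfl
    _ ≤ ∑ b, ∑ i, qent n M b i * ‖A i‖ ^ 2 := Finset.sum_le_sum fun b _ => normSq_QvOp_mulVec_le n M A b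
    _ = ∑ i, (∑ b, qent n M b i) * ‖A i‖ ^ 2 := by rw [Finset.sum_comm]; simp only [Finset.sum_mul]
    _ = 1 / (n : ℝ) ^ d * nsq A := by simp only [qent_colsum, ← Finset.mul_sum]; rfl

/-! ## §2. The `H¹`-stability of the block average `Q′_k` (1.20), constant one -/

/-- (1.55) on vectors: `∂₁ (Q′_k f) = Q_k (∂^η f)` (`Beta.VectorPropagatorDict.QvOp_mul_GradOp` BY NAME).
[cite: Balaban1984PropagatorsI, (1.55) p.27] -/
theorem GradOp_QsOp_mulVec (f : Tor (fine n M) → ℂ) :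
    GradOp M 1 *ᵥ (QsOp n M *ᵥ f) = QvOp n M *ᵥ (GradOp (fine n M) (n : ℂ) *ᵥ f) := by
  rw [Matrix.mulVec_mulVec, Matrix.mulVec_mulVec, QvOp_mul_GradOp]

/-- **THE `H¹`-STABILITY OF PRINT's BLOCK AVERAGE, CONSTANT ONE**: for every scalar `f` on `T_η`,
`Σ_{(y,μ)} ‖(∂₁ Q′_k f)(y,μ)‖² ≤ η^d · Σ_{(x,μ)} ‖(∂^η f)(x,μ)‖²` (`η^d = 1∕n^d`; `∂^η = GradOp (fine n M) n` carries the lattice factor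
`η⁻¹ = n`, `∂₁ = GradOp M 1`).  The torus twin, at the averaging, of `B5Ineq167LowerZd.energy_blockAvg_le`. [folklore] -/
theorem nsq_GradOp_QsOp_le (f : Tor (fine n M) → ℂ) :
    nsq (GradOp M 1 *ᵥ (QsOp n M *ᵥ f)) ≤ 1 / (n : ℝ) ^ d * nsq (GradOp (fine n M) (n : ℂ) *ᵥ f) := by
  rw [GradOp_QsOp_mulVec]
  exact nsq_QvOp_mulVec_le n M _

/-- The same in the printed sums: `Σ_y Σ_μ |(Q′f)(y + e_μ) − (Q′f)(y)|² ≤ η^d · Σ_x Σ_μ |η⁻¹(f(x + ηe_μ) − f(x))|²`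
(`= η^{d−2}·Σ_x Σ_μ |f(x + ηe_μ) − f(x)|²`). [folklore] -/
theorem sum_normSq_diff_QsOp_le (f : Tor (fine n M) → ℂ) :
    ∑ y, ∑ μ, ‖(QsOp n M *ᵥ f) (y + unitVec M μ) - (QsOp n M *ᵥ f) y‖ ^ 2
      ≤ 1 / (n : ℝ) ^ d * ∑ x, ∑ μ, ‖(n : ℂ) * (f (x + unitVec (fine n M) μ) - f x)‖ ^ 2 := by
  have h := nsq_GradOp_QsOp_le n M f
  simp only [nsq, Fintype.sum_prod_type, GradOp_mulVec, sdiff_mulVec, one_mul] at h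
  exact h

/-- The same through the Laplacians `Δ = ∂ᴴ∂` (`B5Action121.LapS`, (1.21)): `⟨Q′f, Δ₁ Q′f⟩ ≤ η^d·⟨f, Δ^η f⟩` (both sides are the real
numbers `‖∂₁Q′f‖²`, `η^d‖∂^ηf‖²`). [folklore] -/
theorem form_LapS_QsOp_le (f : Tor (fine n M) → ℂ) :
    (star (QsOp n M *ᵥ f) ⬝ᵥ (LapS M 1 *ᵥ (QsOp n M *ᵥ f))).re
      ≤ 1 / (n : ℝ) ^ d * (star f ⬝ᵥ (LapS (fine n M) (n : ℂ) *ᵥ f)).re := by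
  rw [← GradOp_conjTranspose_mul_GradOp, ← GradOp_conjTranspose_mul_GradOp, form_gram_rect, form_gram_rect,
    star_dotProduct_self, star_dotProduct_self, Complex.ofReal_re, Complex.ofReal_re]
  exact nsq_GradOp_QsOp_le n M f

/-- **`γ₀ = 1` IN PRINT's WEIGHTED CURRENCY (1.21)**: `⟨Q′_k f, Δ₁ Q′_k f⟩_{w = 1} ≤ ⟨f, Δ^η f⟩_{w = η^d}` with `⟨f, g⟩_w = w·Σ f̄ g`
(`B5Action121.ipw`): the unit-lattice Dirichlet energy of the block average is at most the `η`-lattice Dirichlet energy of the field.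
[folklore] -/
theorem ipw_LapS_QsOp_le (f : Tor (fine n M) → ℂ) :
    (ipw M 1 (QsOp n M *ᵥ f) (LapS M 1 *ᵥ (QsOp n M *ᵥ f))).re
      ≤ (ipw (fine n M) (1 / (n : ℝ) ^ d) f (LapS (fine n M) (n : ℂ) *ᵥ f)).re := by
  simp only [ipw, Complex.ofReal_one, one_mul, Complex.re_ofReal_mul]
  exact form_LapS_QsOp_le n M f

/-! ## §3. Real `dotProduct` currency: the hypothesis of `…MatrixFormJunction.domination_transfer`, `γ = 1` -/

/-- the real action of `Q′_k` is the printed block sum: `((re Q′_k) v)(y) = η^d·Σ_j v(n·y + j)`. [cite: Balaban1984PropagatorsI, (1.20) p.20] -/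
theorem reM_QsOp_mulVec (v : Tor (fine n M) → ℝ) (y : Tor M) :
    (reM (QsOp n M) *ᵥ v) y = 1 / (n : ℝ) ^ d * ∑ j : Fin d → Fin n, v (bpt n M y j) := by
  have h := congrFun ((isReal_QsOp n M).cplx_mulVec v) y
  rw [B5RealFields.cplx_apply, QsOp_mulVec] at h
  apply Complex.ofReal_injective
  rw [h]
  simp only [B5RealFields.cplx_apply, Complex.ofReal_mul, Complex.ofReal_div, Complex.ofReal_one, Complex.ofReal_pow,
    Complex.ofReal_natCast, Complex.ofReal_sum]

/-- the real action of `∂` with a real lattice factor `c`: `((re ∂_c) v)(x,ν) = c·(v(x + e_ν) − v x)`. [cite: Balaban1984PropagatorsI, (1.4) p.18] -/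
theorem reM_GradOp_mulVec {N : Fin d → ℕ} [∀ μ, NeZero (N μ)] (c : ℝ) (v : Tor N → ℝ) (x : Tor N) (ν : Fin d) :
    (reM (GradOp N (c : ℂ)) *ᵥ v) (x, ν) = c * (v (x + unitVec N ν) - v x) := by
  have h := congrFun ((isReal_GradOp N (Complex.conj_ofReal c)).cplx_mulVec v) (x, ν)
  rw [B5RealFields.cplx_apply, GradOp_mulVec, sdiff_mulVec] at h
  simp only [B5RealFields.cplx_apply] at h
  exact_mod_cast h

omit [NeZero n] hM in
/-- `u ⬝ ((BᵀB) u) = Σ_i (B u)_i²` for real matrices. [folklore] -/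
theorem dot_transpose_mul_self {ι κ : Type*} [Fintype ι] [Fintype κ] (B : Matrix κ ι ℝ) (u : ι → ℝ) :
    u ⬝ᵥ ((Bᵀ * B) *ᵥ u) = ∑ i, (B *ᵥ u) i ^ 2 := by
  rw [← Matrix.mulVec_mulVec, Matrix.dotProduct_mulVec, Matrix.vecMul_transpose]
  simp only [dotProduct, sq]

omit hM in
/-- `Σ_i ((re X) u)_i² = nsq (X (u : ℂ))` for a real typed operator `X`. [folklore] -/
theorem sum_sq_reM_mulVec {ι κ : Type*} [Fintype ι] [Fintype κ] {X : Matrix κ ι ℂ} (hX : IsReal X) (u : ι → ℝ) :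
    ∑ i, (reM X *ᵥ u) i ^ 2 = nsq (X *ᵥ cplx u) := by
  rw [← hX.cplx_mulVec, nsq_cplx]

/-- READING of the coarse matrix form: `g ⬝ ((re ∂₁)ᵀ(re ∂₁) g) = Σ_y Σ_μ (g(y + e_μ) − g(y))²` — the unit-lattice Dirichlet energy of a
real scalar field on `T₁ = Tor M`. [folklore] -/
theorem coarse_form_eq (g : Tor M → ℝ) :
    g ⬝ᵥ (((reM (GradOp M 1))ᵀ * reM (GradOp M 1)) *ᵥ g) = ∑ y, ∑ μ, (g (y + unitVec M μ) - g y) ^ 2 := by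
  rw [dot_transpose_mul_self, Fintype.sum_prod_type]
  refine Finset.sum_congr rfl fun y _ => Finset.sum_congr rfl fun μ _ => ?_
  have h := reM_GradOp_mulVec (N := M) 1 g y μ
  rw [Complex.ofReal_one, one_mul] at h
  rw [h]

/-- READING of the fine matrix form: `v ⬝ (η^d·(re ∂^η)ᵀ(re ∂^η) v) = η^d·Σ_x Σ_μ (η⁻¹(v(x + ηe_μ) − v(x)))²` — the `η^d`-weighted
Dirichlet energy (1.21) of a real scalar field on `T_η = Tor (fine n M)`. [folklore] -/
theorem fine_form_eq (v : Tor (fine n M) → ℝ) :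
    v ⬝ᵥ (((1 / (n : ℝ) ^ d) • ((reM (GradOp (fine n M) (n : ℂ)))ᵀ * reM (GradOp (fine n M) (n : ℂ)))) *ᵥ v)
      = 1 / (n : ℝ) ^ d * ∑ x, ∑ μ, ((n : ℝ) * (v (x + unitVec (fine n M) μ) - v x)) ^ 2 := by
  rw [Matrix.smul_mulVec, dotProduct_smul, smul_eq_mul, dot_transpose_mul_self, Fintype.sum_prod_type]
  congr 1
  refine Finset.sum_congr rfl fun x _ => Finset.sum_congr rfl fun μ _ => ?_
  have h := reM_GradOp_mulVec (N := fine n M) (n : ℝ) v x μ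
  rw [Complex.ofReal_natCast] at h
  rw [h]

/-- **THE PULLBACK DOMINATION IN REAL `dotProduct` CURRENCY, `γ = 1`** — literally the hypothesis `h` of
`…MatrixFormJunction.domination_transfer` with `Dm = re Q′_k`, `S = (re ∂₁)ᵀ(re ∂₁)` (the unit-lattice Dirichlet matrix) and
`A = η^d·(re ∂^η)ᵀ(re ∂^η)` (the `η`-weighted fine Dirichlet matrix): for every real scalar field `v` on `T_η`,
`1·((Dm v) ⬝ (S (Dm v))) ≤ v ⬝ (A v)`. [folklore] -/
theorem blockAverage_domination_dot (v : Tor (fine n M) → ℝ) :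
    1 * ((reM (QsOp n M) *ᵥ v) ⬝ᵥ (((reM (GradOp M 1))ᵀ * reM (GradOp M 1)) *ᵥ (reM (QsOp n M) *ᵥ v)))
      ≤ v ⬝ᵥ (((1 / (n : ℝ) ^ d) • ((reM (GradOp (fine n M) (n : ℂ)))ᵀ * reM (GradOp (fine n M) (n : ℂ)))) *ᵥ v) := by
  have h1r : IsReal (GradOp M (1 : ℂ)) := isReal_GradOp M (by simp)
  have hnr : IsReal (GradOp (fine n M) (n : ℂ)) := isReal_GradOp (fine n M) (by simp)
  rw [one_mul, Matrix.smul_mulVec, dotProduct_smul, smul_eq_mul, dot_transpose_mul_self, dot_transpose_mul_self,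
    sum_sq_reM_mulVec h1r, sum_sq_reM_mulVec hnr, (isReal_QsOp n M).cplx_mulVec]
  exact nsq_GradOp_QsOp_le n M (cplx v)

/-! ## §4. The CLM inhabitant of DMT's `hRQ` on `EuclideanSpace ℝ (Tor (fine n M))` -/

/-- **THE HARD FLOW's BLOCK AVERAGE INHABITS `…DominationTransfer`'s `hRQ`, `γ = 1`, LEVEL-FREE.**  On `E = EuclideanSpace ℝ (Tor (fine n M))`
(real scalar fields on `T_η`, `η = 1∕n`, ANY `n` — one step `n = L` or the composite `n = L^k`) and `F = EuclideanSpace ℝ (Tor M)` there are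
continuous bilinear forms `Q` on `E` (the `η^d`-weighted fine Dirichlet form), `R` on `F` (the unit-lattice Dirichlet form) and a continuous
linear map `D : E →L F` (print's block average `Q′_k` in coordinates) with `R (D x) (D x) ≤ Q x x` for all `x`; both forms are nonnegative.
(`…MatrixFormJunction.exists_form ∕ exists_map ∕ domination_transfer` + §3.) [folklore] -/
theorem blockAverage_hRQ :
    ∃ (Q : EuclideanSpace ℝ (Tor (fine n M)) →L[ℝ] EuclideanSpace ℝ (Tor (fine n M)) →L[ℝ] ℝ)
      (R : EuclideanSpace ℝ (Tor M) →L[ℝ] EuclideanSpace ℝ (Tor M) →L[ℝ] ℝ)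
      (D : EuclideanSpace ℝ (Tor (fine n M)) →L[ℝ] EuclideanSpace ℝ (Tor M)),
      (∀ x y, Q x y = ofLp x ⬝ᵥ
        (((1 / (n : ℝ) ^ d) • ((reM (GradOp (fine n M) (n : ℂ)))ᵀ * reM (GradOp (fine n M) (n : ℂ)))) *ᵥ ofLp y)) ∧
      (∀ g h, R g h = ofLp g ⬝ᵥ (((reM (GradOp M 1))ᵀ * reM (GradOp M 1)) *ᵥ ofLp h)) ∧
      (∀ x, ofLp (D x) = reM (QsOp n M) *ᵥ ofLp x) ∧
      (∀ x, 1 * R (D x) (D x) ≤ Q x x) ∧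
      (∀ x, 0 ≤ Q x x) ∧ (∀ g, 0 ≤ R g g) := by
  classical
  obtain ⟨Q, hQ⟩ := exists_form (ι := Tor (fine n M))
    ((1 / (n : ℝ) ^ d) • ((reM (GradOp (fine n M) (n : ℂ)))ᵀ * reM (GradOp (fine n M) (n : ℂ))))
  obtain ⟨R, hR⟩ := exists_form (ι := Tor M) ((reM (GradOp M 1))ᵀ * reM (GradOp M 1))
  obtain ⟨D, hD⟩ := exists_map (ι := Tor (fine n M)) (κ := Tor M) (reM (QsOp n M))
  refine ⟨Q, R, D, hQ, hR, hD, domination_transfer hQ hR hD (blockAverage_domination_dot n M), fun x => ?_, fun g => ?_⟩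
  · rw [hQ, Matrix.smul_mulVec, dotProduct_smul, smul_eq_mul, dot_transpose_mul_self]
    exact mul_nonneg (by positivity) (Finset.sum_nonneg fun i _ => sq_nonneg _)
  · rw [hR, dot_transpose_mul_self]
    exact Finset.sum_nonneg fun i _ => sq_nonneg _

/-- **COMPOSED WITH `…DominationTransfer` (its §1, BY NAME): ALONG ANY SECTION OF PRINT's BLOCK AVERAGE THE TRANSPORTED FINE DIRICHLET
FORM DOMINATES THE UNIT-LATTICE DIRICHLET FORM.**  `Q`, `R`, `D` characterised in coordinates as in `blockAverage_hRQ`; `T : F →L E` ANY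
continuous right inverse of `D` (`D (T g) = g`: a block-constant interpolation, the minimiser of `Q` on the fibre `{D = g}`, …) ⟹
`R g g ≤ (Q.bilinearComp T T) g g` for every coarse field `g`, i.e. `Σ_y Σ_μ (g(y+e_μ) − g(y))² ≤ ⟨Tg, (−Δ^η) Tg⟩_η`.  At the minimising
section this is the lower direction `γ₀ = 1` of print's (1.67) «`Δ_k ≥ γ₀(−Δ)`» for the SCALAR `U = 1` torus flow at the composite level
`n = L^k` (the tree's `ℤ^d` twin: `B5Ineq167LowerZd`; the vector torus form: `Beta.Ineq167Operator.ineq167_lower`) — here for every section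
at once, with no minimisation used. [folklore] -/
theorem transported_dominates_of_section
    {Q : EuclideanSpace ℝ (Tor (fine n M)) →L[ℝ] EuclideanSpace ℝ (Tor (fine n M)) →L[ℝ] ℝ}
    {R : EuclideanSpace ℝ (Tor M) →L[ℝ] EuclideanSpace ℝ (Tor M) →L[ℝ] ℝ}
    {D : EuclideanSpace ℝ (Tor (fine n M)) →L[ℝ] EuclideanSpace ℝ (Tor M)}
    {T : EuclideanSpace ℝ (Tor M) →L[ℝ] EuclideanSpace ℝ (Tor (fine n M))}
    (hQ : ∀ x y, Q x y = ofLp x ⬝ᵥ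
      (((1 / (n : ℝ) ^ d) • ((reM (GradOp (fine n M) (n : ℂ)))ᵀ * reM (GradOp (fine n M) (n : ℂ)))) *ᵥ ofLp y))
    (hR : ∀ g h, R g h = ofLp g ⬝ᵥ (((reM (GradOp M 1))ᵀ * reM (GradOp M 1)) *ᵥ ofLp h))
    (hD : ∀ x, ofLp (D x) = reM (QsOp n M) *ᵥ ofLp x) (hT : ∀ g, D (T g) = g) (g : EuclideanSpace ℝ (Tor M)) :
    R g g ≤ (Q.bilinearComp T T) g g :=
  le_transported_of_le_pullback Q R hT
    (fun x => by simpa only [one_mul] using domination_transfer hQ hR hD (blockAverage_domination_dot n M) x) g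

/-! ## §5. Toy -/

/-- Toy: at the composite blocking of `k` hard steps, `n = L^k`, the weight `η^d = 1∕n^d` is `L^{−kd}`; at `d = 4`, `L = 2`, `k = 3` it is
`2^{−12} = 1∕4096`. -/
example : (1 : ℝ) / ((2 ^ 3 : ℕ) : ℝ) ^ 4 = 1 / 4096 := by norm_num

end Summit.QuantumFields.BalabanUV.T4Continuum.NE7b.BlockAverageDirichletDomination
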